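import Literature.MathematicalPhysics.QuantumFieldTheory.Balaban1983to89.B4Eq19LatticeOperators

/-!
# `Balaban1983to89.B4Eq19LatticeCaccioppoli` — T. Bałaban, *Propagators and renormalization transformations for lattice gauge theories. II*,
# Commun. Math. Phys. **96** (1984) 223–250 [Balaban1984PropagatorsII] (1.9) p. 226: **THE CACCIOPPOLI INEQUALITY ON `ℤ^d`** for the massive lattice
# equation `(−Δ + κ)u = ∂*g` (`κ ≥ 0`) — `Σ_{Q_ρ(z)} |∇u|² ≤ (14d∕s²)·Σ_{Q_{ρ+s+2}(z)} u² + 4·Σ_{Q_{ρ+s+1}(z)} |g|²` — the first step of the energy ∕ Campanato road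
# ([Giaquinta1984] Ch. III §2) to the LOCAL η-scale Hölder estimate `Hloc` of `B9Eq343FlatWindowLetterOfLocalHolder`.

statement-level skeleton of published theorems with citation tags; proofs where landed; nothing here is a claim about the Yang–Mills mass gap

CITATION HEADER (lean-in-tree rule).  Audit cell `pub-balaban`, sub-cell `t4`, BINDER row NE9; filed by NE9 crux-team LEAF PROVER 01
(`b2b-balaban-t4-ne9-formalise-leaf-01`, gen 94; bears_on: R4/N22).  CONTENT: [folklore] lattice analysis — the discrete Caccioppoli inequality with a
Lipschitz cutoff built from nested boxes (continuum: [Giaquinta1984] Ch. III (2.3)–(2.4) p. 77); nothing of [Balaban1984PropagatorsII] is asserted.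

WHAT IS PROVED (sorry-free; proof lane — 0 `def`).
* `exists_cutoff` — a cutoff `χ : ℤ^d → [0, 1]`, `χ = 1` on `Q_{ρ+1}(z)`, `χ = 0` off `Q_{ρ+s}(z)`, `|χ(y + e_μ) − χ(y)| ≤ 1∕s`.
* **`caccioppoli`** — for `κ ≥ 0`, `s ≥ 1` and `(−Δ+κ)u = ∂*g` on `Q_{ρ+s}(z)`:
  `gradSq u (Q_ρ(z)) ≤ (14d∕s²)·Σ_{y ∈ Q_{ρ+s+2}(z)} u(y)² + 4·Σ_{y ∈ Q_{ρ+s+1}(z)} Σ_μ g(y, μ)²`.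
* **`caccioppoli_harmonic`** — the case `g = 0`: `gradSq h (Q_ρ(z)) ≤ (14d∕s²)·Σ_{Q_{ρ+s+2}(z)} h²` for `κ`-harmonic `h`.
HONEST SCOPE.  [folklore] lattice analysis on `ℤ^d`; one step of the road to `Hloc`; NOT summit progress (cell pub-balaban: NE9 NOT PRINTED ∕ NOT PROVED;
spine PROVED 0∕9; finite T⁴ — NOT infinite volume, NOT mass gap, NOT BetaPertH, NOT Clay).  NEW file importing `B4Eq19LatticeOperators` only.
Net new unproved facts: 0.
-/

noncomputable section

open scoped BigOperators
open Finset

namespace Literature.MathematicalPhysics.QuantumFieldTheory.Balaban1983to89.B4Eq19LatticeCaccioppoli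

open B4Eq19LatticeOperators

variable {d : ℕ}

/-! ## §1 The cutoff -/

/-- **A lattice cutoff between two boxes**: for `ρ ≥ 0`, `s ≥ 1` there is `χ : ℤ^d → [0,1]` with `χ = 1` on `Q_{ρ+1}(z)`, `χ = 0` off `Q_{ρ+s}(z)` and
`|χ(y + e_μ) − χ(y)| ≤ 1∕s` (take `χ = clamp((ρ + s + 1 − |y − z|_∞)∕s)`). [folklore] [cite: Giaquinta1984, Ch. III §2 p.77] -/
theorem exists_cutoff (z : Zd d) {ρ s : ℤ} (hρ : 0 ≤ ρ) (hs : 1 ≤ s) :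
    ∃ χ : Zd d → ℝ, (∀ y, 0 ≤ χ y) ∧ (∀ y, χ y ≤ 1) ∧ (∀ y ∈ box z (ρ + 1), χ y = 1) ∧ (∀ y ∉ box z (ρ + s), χ y = 0) ∧
      (∀ y (μ : Fin d), |χ (y + unitVec μ) - χ y| ≤ 1 / s) := by
  classical
  -- the sup-norm distance to `z`, as a natural number
  set Nn : Zd d → ℕ := fun y => Finset.univ.sup fun i => (y i - z i).natAbs with hNn
  have hN_box : ∀ (y : Zd d) (r : ℤ), 0 ≤ r → (y ∈ box z r ↔ ((Nn y : ℤ) ≤ r)) := by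
    intro y r hr
    rw [mem_box]
    constructor
    · intro h
      have h' : Nn y ≤ r.toNat := by
        apply Finset.sup_le
        intro i _
        have h2 : ((y i - z i).natAbs : ℤ) ≤ r := by rw [Int.natCast_natAbs]; exact h i
        omega
      have : ((Nn y : ℕ) : ℤ) ≤ (r.toNat : ℤ) := by exact_mod_cast h'
      rwa [Int.toNat_of_nonneg hr] at this
    · intro h i
      have h1 : (y i - z i).natAbs ≤ Nn y := Finset.le_sup (f := fun i => (y i - z i).natAbs) (Finset.mem_univ i)
      have h4 : ((y i - z i).natAbs : ℤ) ≤ r := le_trans (by exact_mod_cast h1) h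
      rwa [Int.natCast_natAbs] at h4
  have key : ∀ (a b : Zd d), (∀ i, |(a - b) i| ≤ 1) → Nn a ≤ Nn b + 1 := by
    intro a b hab
    apply Finset.sup_le
    intro i _
    have hb : (b i - z i).natAbs ≤ Nn b := Finset.le_sup (f := fun i => (b i - z i).natAbs) (Finset.mem_univ i)
    have hab' := hab i
    simp only [Pi.sub_apply] at hab'
    have h3 : (a i - b i).natAbs ≤ 1 := by
      have := hab'; rw [← Int.natCast_natAbs] at this; exact_mod_cast this
    have e : a i - z i = (b i - z i) + (a i - b i) := by ring
    have : (a i - z i).natAbs ≤ (b i - z i).natAbs + (a i - b i).natAbs := by rw [e]; exact Int.natAbs_add_le _ _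
    omega
  have hN_step : ∀ (y : Zd d) (μ : Fin d), Nn (y + unitVec μ) ≤ Nn y + 1 ∧ Nn y ≤ Nn (y + unitVec μ) + 1 := by
    intro y μ
    refine ⟨key _ _ fun i => ?_, key _ _ fun i => ?_⟩
    · simp only [Pi.sub_apply, Pi.add_apply, add_sub_cancel_left]; exact abs_unitVec_apply_le μ i
    · simp only [Pi.sub_apply, Pi.add_apply, sub_add_cancel_left, abs_neg]; exact abs_unitVec_apply_le μ i
  have hs0 : (0 : ℝ) < s := by exact_mod_cast (show (0 : ℤ) < s by linarith)
  have hclamp : ∀ a b : ℝ, |min 1 (max 0 a) - min 1 (max 0 b)| ≤ |a - b| := by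
    intro a b
    calc |min 1 (max 0 a) - min 1 (max 0 b)| ≤ max |(1:ℝ) - 1| |max 0 a - max 0 b| := abs_min_sub_min_le_max _ _ _ _
      _ = |max 0 a - max 0 b| := by simp [abs_nonneg]
      _ ≤ max |(0:ℝ) - 0| |a - b| := abs_max_sub_max_le_max _ _ _ _
      _ = |a - b| := by simp [abs_nonneg]
  refine ⟨fun y => min 1 (max 0 ((ρ + s + 1 - (Nn y : ℝ)) / s)), fun y => ?_, fun y => ?_, fun y hy => ?_, fun y hy => ?_,
    fun y μ => ?_⟩
  · exact le_min zero_le_one (le_max_left _ _)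
  · exact min_le_left _ _
  · show min 1 (max 0 ((ρ + s + 1 - (Nn y : ℝ)) / s)) = 1
    have h1 : ((Nn y : ℤ) : ℝ) ≤ ((ρ + 1 : ℤ) : ℝ) := by exact_mod_cast (hN_box y (ρ + 1) (by linarith)).1 hy
    push_cast at h1
    have h2 : (1 : ℝ) ≤ (ρ + s + 1 - (Nn y : ℝ)) / s := by
      rw [le_div_iff₀ hs0]; linarith
    rw [min_eq_left]
    exact le_trans h2 (le_max_right _ _)
  · show min 1 (max 0 ((ρ + s + 1 - (Nn y : ℝ)) / s)) = 0
    have h1 : ¬ ((Nn y : ℤ) ≤ ρ + s) := fun h => hy ((hN_box y (ρ + s) (by linarith)).2 h)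
    have h2 : ρ + s + 1 ≤ (Nn y : ℤ) := by omega
    have h3 : ((ρ + s + 1 : ℤ) : ℝ) ≤ ((Nn y : ℤ) : ℝ) := by exact_mod_cast h2
    push_cast at h3
    have h4 : (ρ + s + 1 - (Nn y : ℝ)) / s ≤ 0 := div_nonpos_of_nonpos_of_nonneg (by linarith) hs0.le
    rw [max_eq_left h4, min_eq_right zero_le_one]
  · show |min 1 (max 0 ((ρ + s + 1 - (Nn (y + unitVec μ) : ℝ)) / s)) - min 1 (max 0 ((ρ + s + 1 - (Nn y : ℝ)) / s))| ≤ 1 / s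
    refine (hclamp _ _).trans ?_
    rw [show (ρ + s + 1 - (Nn (y + unitVec μ) : ℝ)) / s - (ρ + s + 1 - (Nn y : ℝ)) / s = ((Nn y : ℝ) - (Nn (y + unitVec μ) : ℝ)) / s by ring,
      abs_div, abs_of_pos hs0]
    apply div_le_div_of_nonneg_right _ hs0.le
    rw [abs_le]
    obtain ⟨h1, h2⟩ := hN_step y μ
    have h1' : ((Nn (y + unitVec μ) : ℕ) : ℝ) ≤ ((Nn y + 1 : ℕ) : ℝ) := by exact_mod_cast h1
    have h2' : ((Nn y : ℕ) : ℝ) ≤ ((Nn (y + unitVec μ) + 1 : ℕ) : ℝ) := by exact_mod_cast h2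
    push_cast at h1' h2'
    constructor <;> linarith

/-! ## §2 The pointwise Young-type inequality behind Caccioppoli -/

/-- The scalar inequality used bond by bond: with `0 ≤ χ₀, χ₁ ≤ 1`, `|χ₁ − χ₀| ≤ δ`,
`−(χ₁+χ₀)(χ₁−χ₀)u₀(u₁−u₀) + χ₁²(u₁−u₀)g + (χ₁+χ₀)(χ₁−χ₀)u₀g ≤ ½χ₁²(u₁−u₀)² + (13∕2)δ²u₀² + ½δ²u₁² + 2g²`. [folklore]
[cite: Giaquinta1984, Ch. III §2 (2.4) p.77] -/
theorem pointwise_young {χ₀ χ₁ u₀ u₁ g δ : ℝ} (h0 : 0 ≤ χ₀) (h0' : χ₀ ≤ 1) (h1 : 0 ≤ χ₁) (h1' : χ₁ ≤ 1) (hδ : |χ₁ - χ₀| ≤ δ) :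
    -((χ₁ + χ₀) * (χ₁ - χ₀) * u₀ * (u₁ - u₀)) + χ₁ ^ 2 * (u₁ - u₀) * g + (χ₁ + χ₀) * (χ₁ - χ₀) * u₀ * g ≤
      (1 / 2) * (χ₁ * (u₁ - u₀)) ^ 2 + (13 / 2) * δ ^ 2 * u₀ ^ 2 + (1 / 2) * δ ^ 2 * u₁ ^ 2 + 2 * g ^ 2 := by
  have hδ0 : 0 ≤ δ := (abs_nonneg _).trans hδ
  set e := χ₁ - χ₀ with he
  set a := χ₁ * (u₁ - u₀) with ha
  have he2 : e ^ 2 ≤ δ ^ 2 := sq_le_sq' (by linarith [(abs_le.1 hδ).1]) (abs_le.1 hδ).2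
  have hsum : χ₁ + χ₀ = 2 * χ₁ - e := by rw [he]; ring
  -- term 1
  have t1 : -((χ₁ + χ₀) * e * u₀ * (u₁ - u₀)) ≤ (1 / 4) * a ^ 2 + 4 * δ ^ 2 * u₀ ^ 2 + δ ^ 2 * ((3 / 2) * u₀ ^ 2 + (1 / 2) * u₁ ^ 2) := by
    have e1 : -((χ₁ + χ₀) * e * u₀ * (u₁ - u₀)) = -(2 * (e * u₀) * a) + e ^ 2 * (u₀ * (u₁ - u₀)) := by
      rw [hsum, ha]; ring
    rw [e1]
    have i1 : -(2 * (e * u₀) * a) ≤ (1 / 4) * a ^ 2 + 4 * (e * u₀) ^ 2 := by nlinarith [sq_nonneg (a / 2 + 2 * (e * u₀))]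
    have i2 : 4 * (e * u₀) ^ 2 ≤ 4 * δ ^ 2 * u₀ ^ 2 := by rw [mul_pow]; nlinarith [sq_nonneg u₀]
    have i3 : u₀ * (u₁ - u₀) ≤ (3 / 2) * u₀ ^ 2 + (1 / 2) * u₁ ^ 2 := by nlinarith [sq_nonneg (u₀ - u₁), sq_nonneg u₀]
    have i3' : -((3 / 2) * u₀ ^ 2 + (1 / 2) * u₁ ^ 2) ≤ u₀ * (u₁ - u₀) := by nlinarith [sq_nonneg (u₀ + u₁), sq_nonneg u₀]
    have i4 : e ^ 2 * (u₀ * (u₁ - u₀)) ≤ δ ^ 2 * ((3 / 2) * u₀ ^ 2 + (1 / 2) * u₁ ^ 2) := by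
      have hA : |u₀ * (u₁ - u₀)| ≤ (3 / 2) * u₀ ^ 2 + (1 / 2) * u₁ ^ 2 := abs_le.2 ⟨i3', i3⟩
      calc e ^ 2 * (u₀ * (u₁ - u₀)) ≤ e ^ 2 * |u₀ * (u₁ - u₀)| := mul_le_mul_of_nonneg_left (le_abs_self _) (sq_nonneg _)
        _ ≤ δ ^ 2 * ((3 / 2) * u₀ ^ 2 + (1 / 2) * u₁ ^ 2) := mul_le_mul he2 hA (abs_nonneg _) (sq_nonneg _)
    linarith
  -- term 2
  have t2 : χ₁ ^ 2 * (u₁ - u₀) * g ≤ (1 / 4) * a ^ 2 + g ^ 2 := by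
    have e2 : χ₁ ^ 2 * (u₁ - u₀) * g = χ₁ * (a * g) := by rw [ha]; ring
    rw [e2]
    have i1 : a * g ≤ (1 / 4) * a ^ 2 + g ^ 2 := by nlinarith [sq_nonneg (a / 2 - g)]
    have i1' : |a * g| ≤ (1 / 4) * a ^ 2 + g ^ 2 := abs_le.2 ⟨by nlinarith [sq_nonneg (a / 2 + g)], i1⟩
    calc χ₁ * (a * g) ≤ χ₁ * |a * g| := mul_le_mul_of_nonneg_left (le_abs_self _) h1
      _ ≤ 1 * |a * g| := mul_le_mul_of_nonneg_right h1' (abs_nonneg _)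
      _ ≤ (1 / 4) * a ^ 2 + g ^ 2 := by rw [one_mul]; exact i1'
  -- term 3
  have t3 : (χ₁ + χ₀) * e * u₀ * g ≤ δ ^ 2 * u₀ ^ 2 + g ^ 2 := by
    have hb : |χ₁ + χ₀| ≤ 2 := abs_le.2 ⟨by linarith, by linarith⟩
    have hA : |e * u₀ * g| ≤ (1 / 2) * (δ ^ 2 * u₀ ^ 2 + g ^ 2) := by
      rw [abs_mul, abs_mul]
      have : |e| * |u₀| ≤ δ * |u₀| := mul_le_mul_of_nonneg_right hδ (abs_nonneg _)
      calc |e| * |u₀| * |g| ≤ δ * |u₀| * |g| := mul_le_mul_of_nonneg_right this (abs_nonneg _)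
        _ ≤ (1 / 2) * (δ ^ 2 * u₀ ^ 2 + g ^ 2) := by
            nlinarith [sq_nonneg (δ * |u₀| - |g|), sq_abs u₀, sq_abs g, abs_nonneg u₀, abs_nonneg g]
    calc (χ₁ + χ₀) * e * u₀ * g = (χ₁ + χ₀) * (e * u₀ * g) := by ring
      _ ≤ |χ₁ + χ₀| * |e * u₀ * g| := by rw [← abs_mul]; exact le_abs_self _
      _ ≤ 2 * ((1 / 2) * (δ ^ 2 * u₀ ^ 2 + g ^ 2)) := mul_le_mul hb hA (abs_nonneg _) (by norm_num)
      _ = δ ^ 2 * u₀ ^ 2 + g ^ 2 := by ring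
  linarith

/-! ## §3 The Caccioppoli inequality -/

/-- **CACCIOPPOLI INEQUALITY ON `ℤ^d`.**  Let `κ ≥ 0`, `ρ ≥ 0`, `s ≥ 1`, and let `u` solve `(−Δ + κ)u = ∂*g` at every point of `Q_{ρ+s}(z)`.  Then
`Σ_{y ∈ Q_ρ(z)} Σ_μ (∂_μu(y))² ≤ (14d∕s²)·Σ_{y ∈ Q_{ρ+s+2}(z)} u(y)² + 4·Σ_{y ∈ Q_{ρ+s+1}(z)} Σ_μ g(y,μ)²`
(test the equation against `χ²u` with the cutoff of `exists_cutoff`, sum by parts, and absorb by `pointwise_young`; the mass term has the good sign).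
[folklore] [cite: Giaquinta1984, Ch. III §2 (2.3)–(2.4) p.77; Balaban1984PropagatorsII, (1.9) p.226] -/
theorem caccioppoli {κ : ℝ} (hκ : 0 ≤ κ) (u : Zd d → ℝ) (g : Zd d → Fin d → ℝ) (z : Zd d) {ρ s : ℤ} (hρ : 0 ≤ ρ) (hs : 1 ≤ s)
    (hEq : ∀ y ∈ box z (ρ + s), lop κ u y = dvg g y) :
    gradSq u (box z ρ) ≤ (14 * d / (s : ℝ) ^ 2) * ∑ y ∈ box z (ρ + s + 2), u y ^ 2 + 4 * ∑ y ∈ box z (ρ + s + 1), ∑ μ, g y μ ^ 2 := by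
  classical
  obtain ⟨χ, hχ0, hχ1, hχin, hχout, hχlip⟩ := exists_cutoff z hρ hs
  set R : ℤ := ρ + s + 1 with hR
  have hs0 : (0 : ℝ) < s := by exact_mod_cast (show (0 : ℤ) < s by linarith)
  set δ : ℝ := 1 / s with hδ
  have hδ0 : 0 ≤ δ := by positivity
  -- the test function `φ = χ²u` vanishes off `Q_{R-1}(z)`
  set φ : Zd d → ℝ := fun y => χ y ^ 2 * u y with hφ
  have hφ0 : ∀ y ∉ box z (R - 1), φ y = 0 := by
    intro y hy
    have : χ y = 0 := hχout y (by rw [hR] at hy; simpa using hy)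
    simp [hφ, this]
  -- summation by parts on both sides of the equation
  have hL := sum_mul_lop κ φ u z R hφ0
  have hD := sum_mul_dvg φ g z R hφ0
  have hEq' : ∑ y ∈ box z R, φ y * lop κ u y = ∑ y ∈ box z R, φ y * dvg g y := by
    refine Finset.sum_congr rfl fun y _ => ?_
    by_cases hy : y ∈ box z (R - 1)
    · rw [hEq y (by rw [hR] at hy; simpa using hy)]
    · rw [hφ0 y hy, zero_mul, zero_mul]
  -- the identity: I + κ Σ χ²u² = Σ_μ Σ [ -(χ₊+χ)(χ₊-χ) u ∂u + χ₊² ∂u g + (χ₊+χ)(χ₊-χ) u g ]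
  have hfdφ : ∀ (y : Zd d) (μ : Fin d), fdiff μ φ y =
      χ (y + unitVec μ) ^ 2 * fdiff μ u y + (χ (y + unitVec μ) + χ y) * (χ (y + unitVec μ) - χ y) * u y := by
    intro y μ; simp only [hφ, fdiff]; ring
  have hmass : 0 ≤ κ * ∑ y ∈ box z R, φ y * u y := by
    apply mul_nonneg hκ
    apply Finset.sum_nonneg
    intro y _
    simp only [hφ]
    nlinarith [sq_nonneg (χ y * u y)]
  -- I ≤ Σ (pointwise RHS)
  have hI : ∑ y ∈ box z R, ∑ μ, (χ (y + unitVec μ) * fdiff μ u y) ^ 2 ≤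
      ∑ y ∈ box z R, ∑ μ, ((1 / 2) * (χ (y + unitVec μ) * fdiff μ u y) ^ 2 + (13 / 2) * δ ^ 2 * u y ^ 2 +
        (1 / 2) * δ ^ 2 * u (y + unitVec μ) ^ 2 + 2 * g y μ ^ 2) := by
    -- combine: Σ(χ₊∂u)² + κΣφu + Σ cross·∂u-terms = Σ fdφ·g
    have h2 : ∑ y ∈ box z R, ∑ μ, fdiff μ φ y * fdiff μ u y + κ * ∑ y ∈ box z R, φ y * u y =
        ∑ y ∈ box z R, ∑ μ, fdiff μ φ y * g y μ := by rw [← hL, hEq', hD]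
    have h3 : ∑ y ∈ box z R, ∑ μ, (χ (y + unitVec μ) * fdiff μ u y) ^ 2 ≤
        ∑ y ∈ box z R, ∑ μ, (-((χ (y + unitVec μ) + χ y) * (χ (y + unitVec μ) - χ y) * u y * fdiff μ u y) +
          χ (y + unitVec μ) ^ 2 * fdiff μ u y * g y μ + (χ (y + unitVec μ) + χ y) * (χ (y + unitVec μ) - χ y) * u y * g y μ) := by
      have e1 : ∑ y ∈ box z R, ∑ μ, fdiff μ φ y * fdiff μ u y =
          ∑ y ∈ box z R, ∑ μ, ((χ (y + unitVec μ) * fdiff μ u y) ^ 2 +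
            (χ (y + unitVec μ) + χ y) * (χ (y + unitVec μ) - χ y) * u y * fdiff μ u y) := by
        refine Finset.sum_congr rfl fun y _ => Finset.sum_congr rfl fun μ _ => ?_
        rw [hfdφ]; ring
      have e2 : ∑ y ∈ box z R, ∑ μ, fdiff μ φ y * g y μ =
          ∑ y ∈ box z R, ∑ μ, (χ (y + unitVec μ) ^ 2 * fdiff μ u y * g y μ +
            (χ (y + unitVec μ) + χ y) * (χ (y + unitVec μ) - χ y) * u y * g y μ) := by
        refine Finset.sum_congr rfl fun y _ => Finset.sum_congr rfl fun μ _ => ?_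
        rw [hfdφ]; ring
      rw [e1, e2] at h2
      have e3 : ∑ y ∈ box z R, ∑ μ, (-((χ (y + unitVec μ) + χ y) * (χ (y + unitVec μ) - χ y) * u y * fdiff μ u y) +
          χ (y + unitVec μ) ^ 2 * fdiff μ u y * g y μ + (χ (y + unitVec μ) + χ y) * (χ (y + unitVec μ) - χ y) * u y * g y μ) =
          ∑ y ∈ box z R, ∑ μ, (χ (y + unitVec μ) ^ 2 * fdiff μ u y * g y μ +
            (χ (y + unitVec μ) + χ y) * (χ (y + unitVec μ) - χ y) * u y * g y μ) -
          ∑ y ∈ box z R, ∑ μ, (χ (y + unitVec μ) + χ y) * (χ (y + unitVec μ) - χ y) * u y * fdiff μ u y := by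
        rw [← Finset.sum_sub_distrib]
        refine Finset.sum_congr rfl fun y _ => ?_
        rw [← Finset.sum_sub_distrib]
        refine Finset.sum_congr rfl fun μ _ => ?_
        ring
      have e4 : ∑ y ∈ box z R, ∑ μ, ((χ (y + unitVec μ) * fdiff μ u y) ^ 2 +
            (χ (y + unitVec μ) + χ y) * (χ (y + unitVec μ) - χ y) * u y * fdiff μ u y) =
          ∑ y ∈ box z R, ∑ μ, (χ (y + unitVec μ) * fdiff μ u y) ^ 2 +
            ∑ y ∈ box z R, ∑ μ, (χ (y + unitVec μ) + χ y) * (χ (y + unitVec μ) - χ y) * u y * fdiff μ u y := by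
        rw [← Finset.sum_add_distrib]
        refine Finset.sum_congr rfl fun y _ => ?_
        rw [← Finset.sum_add_distrib]
      rw [e4] at h2
      rw [e3]
      linarith
    refine h3.trans (Finset.sum_le_sum fun y _ => Finset.sum_le_sum fun μ _ => ?_)
    have := pointwise_young (u₀ := u y) (u₁ := u (y + unitVec μ)) (g := g y μ) (hχ0 y) (hχ1 y) (hχ0 (y + unitVec μ))
      (hχ1 (y + unitVec μ)) (hχlip y μ)
    simp only [fdiff] at this ⊢
    linarith
  -- absorb: I ≤ 13 δ² Σ u² + δ² Σ u₊² + 4 Σ g²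
  have hI' : ∑ y ∈ box z R, ∑ μ, (χ (y + unitVec μ) * fdiff μ u y) ^ 2 ≤
      13 * δ ^ 2 * ∑ y ∈ box z R, ∑ μ : Fin d, u y ^ 2 + δ ^ 2 * ∑ y ∈ box z R, ∑ μ, u (y + unitVec μ) ^ 2 +
        4 * ∑ y ∈ box z R, ∑ μ, g y μ ^ 2 := by
    have e1 : ∑ y ∈ box z R, ∑ μ, ((1 / 2) * (χ (y + unitVec μ) * fdiff μ u y) ^ 2 + (13 / 2) * δ ^ 2 * u y ^ 2 +
        (1 / 2) * δ ^ 2 * u (y + unitVec μ) ^ 2 + 2 * g y μ ^ 2) =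
        (1 / 2) * ∑ y ∈ box z R, ∑ μ, (χ (y + unitVec μ) * fdiff μ u y) ^ 2 + (13 / 2) * δ ^ 2 * ∑ y ∈ box z R, ∑ μ : Fin d, u y ^ 2 +
        (1 / 2) * δ ^ 2 * ∑ y ∈ box z R, ∑ μ, u (y + unitVec μ) ^ 2 + 2 * ∑ y ∈ box z R, ∑ μ, g y μ ^ 2 := by
      simp only [Finset.sum_add_distrib, Finset.mul_sum]
    rw [e1] at hI
    linarith
  -- the pieces: LHS ≤ I, Σ u² terms over the bigger box, Σ u₊² by translation
  have hLHS : gradSq u (box z ρ) ≤ ∑ y ∈ box z R, ∑ μ, (χ (y + unitVec μ) * fdiff μ u y) ^ 2 := by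
    rw [gradSq_def]
    have hsub : box z ρ ⊆ box z R := box_mono z (by rw [hR]; linarith)
    calc ∑ y ∈ box z ρ, ∑ μ, fdiff μ u y ^ 2 = ∑ y ∈ box z ρ, ∑ μ, (χ (y + unitVec μ) * fdiff μ u y) ^ 2 := by
          refine Finset.sum_congr rfl fun y hy => Finset.sum_congr rfl fun μ _ => ?_
          rw [hχin _ (add_unitVec_mem_box hy μ), one_mul]
      _ ≤ ∑ y ∈ box z R, ∑ μ, (χ (y + unitVec μ) * fdiff μ u y) ^ 2 :=
          Finset.sum_le_sum_of_subset_of_nonneg hsub fun _ _ _ => Finset.sum_nonneg fun _ _ => sq_nonneg _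
  have hU1 : ∑ y ∈ box z R, ∑ μ : Fin d, u y ^ 2 ≤ d * ∑ y ∈ box z (ρ + s + 2), u y ^ 2 := by
    have e : ∑ y ∈ box z R, ∑ μ : Fin d, u y ^ 2 = d * ∑ y ∈ box z R, u y ^ 2 := by
      rw [Finset.mul_sum]
      refine Finset.sum_congr rfl fun y _ => ?_
      rw [Finset.sum_const, Finset.card_univ, Fintype.card_fin, nsmul_eq_mul]
    rw [e]
    exact mul_le_mul_of_nonneg_left (Finset.sum_le_sum_of_subset_of_nonneg (box_mono z (by rw [hR]; linarith))
      fun _ _ _ => sq_nonneg _) (Nat.cast_nonneg d)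
  have hU2 : ∑ y ∈ box z R, ∑ μ, u (y + unitVec μ) ^ 2 ≤ d * ∑ y ∈ box z (ρ + s + 2), u y ^ 2 := by
    rw [Finset.sum_comm]
    have : ∀ μ : Fin d, ∑ y ∈ box z R, u (y + unitVec μ) ^ 2 ≤ ∑ y ∈ box z (ρ + s + 2), u y ^ 2 := by
      intro μ
      rw [sum_box_add_right (fun y => u y ^ 2)]
      refine Finset.sum_le_sum_of_subset_of_nonneg (box_subset_box fun i => ?_) fun _ _ _ => sq_nonneg _
      simp only [Pi.add_apply, add_sub_cancel_left]
      rw [hR]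
      linarith [abs_unitVec_apply_le μ i]
    calc ∑ μ, ∑ y ∈ box z R, u (y + unitVec μ) ^ 2 ≤ ∑ μ : Fin d, ∑ y ∈ box z (ρ + s + 2), u y ^ 2 := Finset.sum_le_sum fun μ _ => this μ
      _ = d * ∑ y ∈ box z (ρ + s + 2), u y ^ 2 := by rw [Finset.sum_const, Finset.card_univ, Fintype.card_fin, nsmul_eq_mul]
  have hG : ∑ y ∈ box z R, ∑ μ, g y μ ^ 2 = ∑ y ∈ box z (ρ + s + 1), ∑ μ, g y μ ^ 2 := by rw [hR]
  have hUnn : 0 ≤ ∑ y ∈ box z (ρ + s + 2), u y ^ 2 := Finset.sum_nonneg fun _ _ => sq_nonneg _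
  have hδ2 : δ ^ 2 = 1 / (s : ℝ) ^ 2 := by rw [hδ]; field_simp
  calc gradSq u (box z ρ) ≤ ∑ y ∈ box z R, ∑ μ, (χ (y + unitVec μ) * fdiff μ u y) ^ 2 := hLHS
    _ ≤ 13 * δ ^ 2 * (d * ∑ y ∈ box z (ρ + s + 2), u y ^ 2) + δ ^ 2 * (d * ∑ y ∈ box z (ρ + s + 2), u y ^ 2) +
        4 * ∑ y ∈ box z (ρ + s + 1), ∑ μ, g y μ ^ 2 := by
        rw [← hG]
        have a1 := mul_le_mul_of_nonneg_left hU1 (by positivity : (0:ℝ) ≤ 13 * δ ^ 2)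
        have a2 := mul_le_mul_of_nonneg_left hU2 (by positivity : (0:ℝ) ≤ δ ^ 2)
        linarith
    _ = (14 * d / (s : ℝ) ^ 2) * ∑ y ∈ box z (ρ + s + 2), u y ^ 2 + 4 * ∑ y ∈ box z (ρ + s + 1), ∑ μ, g y μ ^ 2 := by
        rw [hδ2]; ring

/-- **Caccioppoli for `κ`-harmonic functions** (`g = 0`): `Σ_{Q_ρ(z)} |∇h|² ≤ (14d∕s²)·Σ_{Q_{ρ+s+2}(z)} h²`.
[folklore] [cite: Giaquinta1984, Ch. III §2 (2.4) p.77] -/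
theorem caccioppoli_harmonic {κ : ℝ} (hκ : 0 ≤ κ) (h : Zd d → ℝ) (z : Zd d) {ρ s : ℤ} (hρ : 0 ≤ ρ) (hs : 1 ≤ s)
    (hEq : ∀ y ∈ box z (ρ + s), lop κ h y = 0) :
    gradSq h (box z ρ) ≤ (14 * d / (s : ℝ) ^ 2) * ∑ y ∈ box z (ρ + s + 2), h y ^ 2 := by
  have := caccioppoli hκ h (fun _ _ => 0) z hρ hs (fun y hy => by rw [hEq y hy, dvg_apply]; simp)
  simpa using this

end Literature.MathematicalPhysics.QuantumFieldTheory.Balaban1983to89.B4Eq19LatticeCaccioppoli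

end
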